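import Summits.CriticalPhenomena.PercolationContinuityZ3.Theorems.PercNearOneGluingNoHeavyRsw3CrossingBridges
import Summits.CriticalPhenomena.PercolationContinuityZ3.Theorems.PercNearOneGluingNoHeavyRsw3AnnulusUniqGluing
import Summits.CriticalPhenomena.PercolationContinuityZ3.Theorems.PercAnnulusCrossingBoxCrossingLength
import Literature.Probability.Percolation.RSWChainingInputs
import HarnessLib

/-!
# RSW3 lane: hard-direction crossings OR bounded-aspect two-arm events — part 1, the deterministic chain
# (slab coordinates; gluing `k+1` short-way slab crossings through `k` uniqueness zones)

builds on p205010 (kernel theorem, internal audit signed; external expert review pending)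

RSW3 lane (LANE 3 `prim-rsw3`, post-continuity programme), lead seat, gen 2.  Helper file (`--supports`); no definitions,
no named facts, no sorries.  THIS FILE is the deterministic (configuration-wise) half: coordinates of the translated slabs and
the gluing lemma `chain_inConn_of_slabs_uniqZoneAt`; the probability statements listed below are in the sequel
`PercAnnulusCrossingHardOrTwoArms.lean` (split for the 400-line rule).  Everything holds at EVERY `p` on `ℤ³`.

## The dichotomy

Write `Λ(r) = box 3 r = [-r,r]³`, `α₂(n,2n) = Crossing.annulusTwoArmProb 3 p n (2n) = P_p((uniqZone n (2n))ᶜ)` (two vertices of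
`Λ(n)` are joined inside `Λ(2n)` to `∂ⁱⁿΛ(2n)` but not to each other: at least two distinct annulus-crossing clusters — the
(S2-two-arm) event of the lane's defs file), and `E = P_p(boxCross (easyShape 2 n) 0)` for the probability that the block
`{0..n} × {0..2n}²` is crossed the SHORT way (a theorem at `p_c(ℤ³)`: `Crossing.EasyCrossingLowerBound 2`, p208904 / p208907).

Chain `k+1` translated short-way slabs `S_j = [3nj+n, 3nj+2n] × [-n,n]²` (`j = 0, …, k`) along the `x₀`-axis; consecutive slabs
`S_{j-1}, S_j` are the two "arms" of the aspect-2 annulus `Λ(2n) + 3nj·e₀ ⊇ Λ(n) + 3nj·e₀`: a short-way crossing of `S_{j-1}` joins the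
core `Λ(n)+3nj e₀` to the face `{x₀ = 3nj - n… }` of the outer box, one of `S_j` joins the core to the opposite face.  On the
uniqueness zone `uniqZoneAt (3nj e₀) n (2n)` the two crossings are joined inside the outer box.  Hence (Harris for the `k+1` slab
crossings, a union bound for the `k` uniqueness zones, translation invariance):

* `pow_le_real_boxCross_add_mul_annulusTwoArmProb` — **`E^{k+1} ≤ P_p(boxCross ![3nk+n, 4n, 4n] 0) + k · α₂(n,2n)`** for all `p`,
  `n ≥ 1`, `k`: a box of aspect `(3k+1)/4` in the HARD direction is crossed, or local non-uniqueness at aspect 2 is not rare;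
* `sq_le_real_boxCross_cubeShape_add_annulusTwoArmProb` (`k = 1`) — **`E² ≤ P_p(boxCross (cubeShape (4n)) 0) + α₂(n,2n)`**: the CUBE
  of side `4n` is crossed face to face, or the annulus `Λ(2n) ∖ Λ(n)` carries two distinct crossing clusters;
* `pow_le_real_boxCross_hardShape_add_mul_annulusTwoArmProb` — the same for Kesten's hard shapes `hardShape k m`, every side `m ≥ 4`
  (`n = ⌊m/4⌋`, `3k` uniqueness zones, Kesten's Comment (v) monotonicity `real_boxCross_anti`);
* at `p_c(ℤ³)` with the PROVED short-way bound `c₂ ≤ E` (`Rsw3.easyCrossingLowerBound_two`):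
  `exists_le_cube_add_annulusTwoArmProb_criticalProbI` — **`∃ c > 0 ∀ n ≥ 1, c ≤ P_{p_c}(boxCross (cubeShape (4n)) 0) + α₂(n,2n)`**,
  `exists_le_hardShape_add_mul_annulusTwoArmProb_criticalProbI` — `∃ c > 0 ∀ m ≥ 4, c ≤ P_{p_c}(boxCross (hardShape k m) 0) + 3k·α₂(⌊m/4⌋, 2⌊m/4⌋)`,
  and the asymptotic dichotomy `hardCrossingLowerBound_or_frequently_annulusTwoArmProb` —
  **for every `k ≥ 1`: `Crossing.HardCrossingLowerBound k` holds, OR `α₂(n,2n) > ε_k` for infinitely many `n`** (explicit `ε_k > 0`).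

Reading (numbers, not adjectives).  (S1-lo-hard) — uniform hard-direction / cube crossing lower bounds at `p_c(ℤ³)`, "3D RSW" — is
OPEN; the theorem says it can fail ONLY IF two distinct clusters cross the aspect-2 annulus with probability `> ε_k` at infinitely
many scales, i.e. only through bounded-aspect NON-UNIQUENESS — which is exactly what the lane's census sees (`α₂(n,2n) ≈ 1`, `≈ 18`
crossing clusters, CENSUS-CROSSING §0 / CENSUS-QM T6; non-rigorous).  So in `d = 3` the dichotomy is resolved numerically on the
two-arm side and gives NO crossing bound; its content is structural: 3D lower-RSW ⇐ asymptotic local uniqueness at aspect 2 (the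
Pisztora / Grimmett–Marstrand "unique crossing cluster" renormalisation written as an every-scale inequality at every `p`, with the
lane's proved short-way input), complementing LANE 1's blocking-side dichotomy `critical_blocking_or_twoArms` ("annulus BLOCKED or
two-arms", `PercAnnulusCrossingCriticalBlockingOrTwoArms`).  Above six dimensions both (S1-lo-hard) and `α₂ → 1` hold, consistent.

References: H. Kesten, *Percolation Theory for Mathematicians* (1982) §3.3 Comment (v), (3.65), Thm. 5.1; G. Grimmett, *Percolation*
(1999) §7.4 (block events `K(m,n)`, uniqueness inside blocks); S. Martineau, V. Tassion, Trans. AMS 369 (2017) Lemma 3.7 (uniqueness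
zone); H. Duminil-Copin, G. Kozma, V. Tassion (2020) Prop. 1; A. Pisztora, PTRF 104 (1996) (coarse graining with unique crossing
clusters); C. Borgs, J. Chayes, H. Kesten, J. Spencer (1999) §1.
-/

noncomputable section

namespace Summit.CriticalPhenomena.PercolationContinuityZ3.Theorems.Crossing

open MeasureTheory Literature.Probability.LatticeModels Literature.Probability.Percolation
open Literature.Probability.Percolation.KozmaNitzan SimpleGraph
open Summit.CriticalPhenomena.PercolationContinuityZ3.Theorems.SurfaceTension
open Summit.CriticalPhenomena.PercolationContinuityZ3.Theorems.Rsw3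

/-! ## Coordinates: the base slab `{0..n} × {0..2n}²`, its faces, its translates -/

/-- Membership in the base block `{0..n} × {0..2n}² = Finset.Icc 0 (easyShape 2 n)` by coordinates. [folklore] -/
theorem mem_Icc_easyShape_two_iff {n : ℕ} {y : Site 3} :
    y ∈ Finset.Icc (0 : Site 3) (easyShape 2 n) ↔
      (0 ≤ y 0 ∧ y 0 ≤ n) ∧ (0 ≤ y 1 ∧ y 1 ≤ 2 * n) ∧ (0 ≤ y 2 ∧ y 2 ≤ 2 * n) := by
  rw [Finset.mem_Icc, Pi.le_def, Pi.le_def]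
  simp only [Fin.forall_fin_succ, easyShape, Pi.zero_apply]
  simp
  omega

/-- Points of the translate by `v` of a set `S`: `x ∈ (x ↦ x + v) '' S ↔ x - v ∈ S`. [folklore] -/
theorem mem_image_zdShiftIso_iff {d : ℕ} {v : Site d} {S : Set (Site d)} {x : Site d} :
    x ∈ (zdShiftIso v : zdGraph d ≃g zdGraph d) '' S ↔ x - v ∈ S := by
  constructor
  · rintro ⟨y, hy, rfl⟩; simpa [zdShiftIso_apply] using hy
  · intro h; exact ⟨x - v, h, by simp [zdShiftIso_apply]⟩

/-- Coordinates of a point of the `j`-th slab `S_j = [3nj+n, 3nj+2n] × [-n,n]²` (the translate of the base block by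
`(3nj+n, -n, -n)`). [folklore] -/
theorem slab_coords {n j : ℕ} {x : Site 3}
    (hx : x ∈ (zdShiftIso (![3 * (n : ℤ) * j + n, -(n : ℤ), -(n : ℤ)] : Site 3) : zdGraph 3 ≃g zdGraph 3) ''
      (↑(Finset.Icc (0 : Site 3) (easyShape 2 n)) : Set (Site 3))) :
    (3 * (n : ℤ) * j + n ≤ x 0 ∧ x 0 ≤ 3 * (n : ℤ) * j + 2 * n) ∧ (-(n : ℤ) ≤ x 1 ∧ x 1 ≤ n) ∧
      (-(n : ℤ) ≤ x 2 ∧ x 2 ≤ n) := by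
  rw [mem_image_zdShiftIso_iff, Finset.mem_coe, mem_Icc_easyShape_two_iff] at hx
  simp only [Pi.sub_apply, Matrix.cons_val_zero, Matrix.cons_val_one, Matrix.head_cons,
    Matrix.cons_val_two, Matrix.tail_cons] at hx
  omega

/-- Coordinates of a point of the near face `{x₀ = 3nj+n}` of the `j`-th slab. [folklore] -/
theorem slab_face0_coords {n j : ℕ} {x : Site 3}
    (hx : x ∈ (zdShiftIso (![3 * (n : ℤ) * j + n, -(n : ℤ), -(n : ℤ)] : Site 3) : zdGraph 3 ≃g zdGraph 3) ''
      {y : Site 3 | y ∈ Finset.Icc (0 : Site 3) (easyShape 2 n) ∧ y 0 = 0}) :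
    x 0 = 3 * (n : ℤ) * j + n ∧ (-(n : ℤ) ≤ x 1 ∧ x 1 ≤ n) ∧ (-(n : ℤ) ≤ x 2 ∧ x 2 ≤ n) := by
  rw [mem_image_zdShiftIso_iff, Set.mem_setOf_eq, mem_Icc_easyShape_two_iff] at hx
  simp only [Pi.sub_apply, Matrix.cons_val_zero, Matrix.cons_val_one, Matrix.head_cons,
    Matrix.cons_val_two, Matrix.tail_cons] at hx
  omega

/-- Coordinates of a point of the far face `{x₀ = 3nj+2n}` of the `j`-th slab. [folklore] -/
theorem slab_face1_coords {n j : ℕ} {x : Site 3}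
    (hx : x ∈ (zdShiftIso (![3 * (n : ℤ) * j + n, -(n : ℤ), -(n : ℤ)] : Site 3) : zdGraph 3 ≃g zdGraph 3) ''
      {y : Site 3 | y ∈ Finset.Icc (0 : Site 3) (easyShape 2 n) ∧ y 0 = (n : ℤ)}) :
    x 0 = 3 * (n : ℤ) * j + 2 * n ∧ (-(n : ℤ) ≤ x 1 ∧ x 1 ≤ n) ∧ (-(n : ℤ) ≤ x 2 ∧ x 2 ≤ n) := by
  rw [mem_image_zdShiftIso_iff, Set.mem_setOf_eq, mem_Icc_easyShape_two_iff] at hx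
  simp only [Pi.sub_apply, Matrix.cons_val_zero, Matrix.cons_val_one, Matrix.head_cons,
    Matrix.cons_val_two, Matrix.tail_cons] at hx
  omega

/-- Membership in the translated box `Λ(r) + 3nj·e₀` by coordinates. [folklore] -/
theorem mem_ball_axis_iff {n j r : ℕ} {x : Site 3} :
    x ∈ GM.ball (![3 * (n : ℤ) * j, 0, 0] : Site 3) r ↔
      (3 * (n : ℤ) * j - r ≤ x 0 ∧ x 0 ≤ 3 * (n : ℤ) * j + r) ∧ (-(r : ℤ) ≤ x 1 ∧ x 1 ≤ r) ∧
        (-(r : ℤ) ≤ x 2 ∧ x 2 ≤ r) := by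
  rw [GM.mem_ball]
  simp only [Fin.forall_fin_succ, Matrix.cons_val_zero, Matrix.cons_val_succ, Matrix.cons_val_fin_one, sub_zero]
  simp
  omega

/-- A point of `Λ(2n) + 3nj·e₀` with `x₀ = 3nj ± 2n` lies on the inner vertex boundary of that box. [folklore] -/
theorem mem_innerBoundary_ball_axis {n j : ℕ} {x : Site 3}
    (hx : x ∈ GM.ball (![3 * (n : ℤ) * j, 0, 0] : Site 3) (2 * n))
    (h0 : x 0 = 3 * (n : ℤ) * j - 2 * n ∨ x 0 = 3 * (n : ℤ) * j + 2 * n) :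
    x ∈ innerBoundary (zdGraph 3) (GM.ball (![3 * (n : ℤ) * j, 0, 0] : Site 3) (2 * n)) := by
  rw [mem_innerBoundary_ball_iff]
  refine DCT16.mem_innerBoundary_box_of_natAbs_eq (mem_ball_iff_sub.1 hx) (i := 0) ?_
  simp only [Pi.sub_apply, Matrix.cons_val_zero]
  omega

/-! ## The chain of slab crossings glued by uniqueness zones -/

/-- **Gluing slab crossings through uniqueness zones (deterministic step).**  On a lattice configuration `ω ⊆ E(ℤ³)` with
`n ≥ 1`: if each slab `S_j`, `j ≤ k`, is crossed the short way inside itself and the uniqueness zones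
`uniqZoneAt (3nj·e₀) n (2n)`, `1 ≤ j ≤ k`, all hold, then the long box `R_k = [n, 3nk+2n] × [-2n,2n]²` contains an open lattice
path from the near face of `S_0` (`x₀ = n`) to the far face of `S_k` (`x₀ = 3nk+2n`) — together with a short-way crossing of
`S_k` ending at the same point (the induction invariant).  Mechanism: the far end `b` of the chain (on `x₀ = 3nk+2n`) and the near end
`a₁` of the next slab crossing (on `x₀ = 3nk+4n`) both lie in the core `Λ(n) + 3n(k+1)e₀` and both reach the boundary of
`Λ(2n) + 3n(k+1)e₀` inside it (through their own slabs), so the uniqueness zone joins them inside that box.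
[cite: MartineauTassion2017, §3.1.2 and proof of Lemma 3.7 (uniqueness zone)] -/
theorem chain_inConn_of_slabs_uniqZoneAt {n : ℕ} (hn : 1 ≤ n) {ω : BondConfig (Site 3)}
    (hω : ω ⊆ (zdGraph 3).edgeSet) (k : ℕ)
    (hE : ∀ j ≤ k, ω ∈ linked
      ((zdShiftIso (![3 * (n : ℤ) * j + n, -(n : ℤ), -(n : ℤ)] : Site 3) : zdGraph 3 ≃g zdGraph 3) ''
        (↑(Finset.Icc (0 : Site 3) (easyShape 2 n)) : Set (Site 3)))
      ((zdShiftIso (![3 * (n : ℤ) * j + n, -(n : ℤ), -(n : ℤ)] : Site 3) : zdGraph 3 ≃g zdGraph 3) ''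
        {y : Site 3 | y ∈ Finset.Icc (0 : Site 3) (easyShape 2 n) ∧ y 0 = 0})
      ((zdShiftIso (![3 * (n : ℤ) * j + n, -(n : ℤ), -(n : ℤ)] : Site 3) : zdGraph 3 ≃g zdGraph 3) ''
        {y : Site 3 | y ∈ Finset.Icc (0 : Site 3) (easyShape 2 n) ∧ y 0 = (n : ℤ)}))
    (hU : ∀ j, 1 ≤ j → j ≤ k → ω ∈ uniqZoneAt (![3 * (n : ℤ) * j, 0, 0] : Site 3) n (2 * n)) :
    ∃ a ∈ (zdShiftIso (![3 * (n : ℤ) * (0 : ℕ) + n, -(n : ℤ), -(n : ℤ)] : Site 3) : zdGraph 3 ≃g zdGraph 3) ''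
        {y : Site 3 | y ∈ Finset.Icc (0 : Site 3) (easyShape 2 n) ∧ y 0 = 0},
      ∃ b ∈ (zdShiftIso (![3 * (n : ℤ) * k + n, -(n : ℤ), -(n : ℤ)] : Site 3) : zdGraph 3 ≃g zdGraph 3) ''
        {y : Site 3 | y ∈ Finset.Icc (0 : Site 3) (easyShape 2 n) ∧ y 0 = (n : ℤ)},
      ∃ a' ∈ (zdShiftIso (![3 * (n : ℤ) * k + n, -(n : ℤ), -(n : ℤ)] : Site 3) : zdGraph 3 ≃g zdGraph 3) ''
        {y : Site 3 | y ∈ Finset.Icc (0 : Site 3) (easyShape 2 n) ∧ y 0 = 0},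
      ω ∈ inConn {x : Site 3 | ((n : ℤ) ≤ x 0 ∧ x 0 ≤ 3 * (n : ℤ) * k + 2 * n) ∧
          (-(2 * n : ℤ) ≤ x 1 ∧ x 1 ≤ 2 * n) ∧ (-(2 * n : ℤ) ≤ x 2 ∧ x 2 ≤ 2 * n)} a b ∧
      ω ∈ inConn ((zdShiftIso (![3 * (n : ℤ) * k + n, -(n : ℤ), -(n : ℤ)] : Site 3) : zdGraph 3 ≃g zdGraph 3) ''
        (↑(Finset.Icc (0 : Site 3) (easyShape 2 n)) : Set (Site 3))) a' b := by
  induction k with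
  | zero =>
    obtain ⟨a, ha, b, hb, hab⟩ := mem_linked_iff.1 (hE 0 le_rfl)
    refine ⟨a, ha, b, hb, a, ha, inConn_mono (fun x hx => ?_) a b hab, hab⟩
    have h := slab_coords hx
    simp only [Set.mem_setOf_eq]
    omega
  | succ k ih =>
    obtain ⟨a, ha, b, hb, a', ha', hab, ha'b⟩ :=
      ih (fun j hj => hE j (by omega)) (fun j hj1 hjk => hU j hj1 (by omega))
    obtain ⟨a₁, ha₁, b₁, hb₁, ha₁b₁⟩ := mem_linked_iff.1 (hE (k + 1) le_rfl)
    have hUk := hU (k + 1) (by omega) le_rfl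
    -- coordinates
    have cb := slab_face1_coords hb
    have ca' := slab_face0_coords ha'
    have ca₁ := slab_face0_coords ha₁
    have cb₁ := slab_face1_coords hb₁
    -- the outer box `Q = Λ(2n) + 3n(k+1) e₀` and its core
    have e1 : 3 * (n : ℤ) * ((k : ℤ) + 1) = 3 * (n : ℤ) * (k : ℤ) + 3 * n := by ring
    have e0 : 0 ≤ 3 * (n : ℤ) * (k : ℤ) := by positivity
    push_cast at ca₁ cb₁
    set z : Site 3 := ![3 * (n : ℤ) * (k + 1 : ℕ), 0, 0] with hz
    have hslab_k : (zdShiftIso (![3 * (n : ℤ) * k + n, -(n : ℤ), -(n : ℤ)] : Site 3) : zdGraph 3 ≃g zdGraph 3) ''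
        (↑(Finset.Icc (0 : Site 3) (easyShape 2 n)) : Set (Site 3)) ⊆ ↑(GM.ball z (2 * n)) := by
      intro x hx
      have h := slab_coords hx
      rw [Finset.mem_coe, hz, mem_ball_axis_iff]
      push_cast
      omega
    have hslab_k1 : (zdShiftIso (![3 * (n : ℤ) * (k + 1 : ℕ) + n, -(n : ℤ), -(n : ℤ)] : Site 3) :
          zdGraph 3 ≃g zdGraph 3) '' (↑(Finset.Icc (0 : Site 3) (easyShape 2 n)) : Set (Site 3)) ⊆
        ↑(GM.ball z (2 * n)) := by
      intro x hx
      have h := slab_coords hx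
      rw [Finset.mem_coe, hz, mem_ball_axis_iff]
      push_cast at h ⊢
      omega
    have hbQ : b ∈ GM.ball z n := by
      rw [hz, mem_ball_axis_iff]; push_cast; omega
    have ha₁Q : a₁ ∈ GM.ball z n := by
      rw [hz, mem_ball_axis_iff]; push_cast at ca₁ ⊢; omega
    have hbQ2 : b ∈ GM.ball z (2 * n) := by
      rw [hz, mem_ball_axis_iff]; push_cast; omega
    have ha₁Q2 : a₁ ∈ GM.ball z (2 * n) := by
      rw [hz, mem_ball_axis_iff]; push_cast at ca₁ ⊢; omega
    have ha'S : a' ∈ (zdShiftIso (![3 * (n : ℤ) * k + n, -(n : ℤ), -(n : ℤ)] : Site 3) : zdGraph 3 ≃g zdGraph 3) ''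
        (↑(Finset.Icc (0 : Site 3) (easyShape 2 n)) : Set (Site 3)) := by
      obtain ⟨y, hy, hya⟩ := ha'; exact ⟨y, Finset.mem_coe.2 hy.1, hya⟩
    have hb₁S : b₁ ∈ (zdShiftIso (![3 * (n : ℤ) * (k + 1 : ℕ) + n, -(n : ℤ), -(n : ℤ)] : Site 3) :
        zdGraph 3 ≃g zdGraph 3) '' (↑(Finset.Icc (0 : Site 3) (easyShape 2 n)) : Set (Site 3)) := by
      obtain ⟨y, hy, hyb⟩ := hb₁; exact ⟨y, Finset.mem_coe.2 hy.1, hyb⟩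
    -- `b` reaches `∂Q` inside `Q` (through its slab `S_k`, at `a'`), and so does `a₁` (through `S_{k+1}`, at `b₁`)
    have hb_bdry : ω ∈ toBdryAt z (2 * n) b := by
      refine ⟨a', ?_, ?_⟩
      · refine mem_innerBoundary_ball_axis (hslab_k ha'S) (Or.inl ?_)
        push_cast; omega
      · exact mem_openConnIn_of_mem_inConn hbQ2
          (by rw [inConn_comm]; exact inConn_mono hslab_k a' b ha'b)
    have ha₁_bdry : ω ∈ toBdryAt z (2 * n) a₁ := by
      refine ⟨b₁, ?_, ?_⟩
      · refine mem_innerBoundary_ball_axis (hslab_k1 hb₁S) (Or.inr ?_)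
        push_cast; omega
      · exact mem_openConnIn_of_mem_inConn ha₁Q2 (inConn_mono hslab_k1 a₁ b₁ ha₁b₁)
    -- the uniqueness zone glues `b` to `a₁` inside `Q`
    have hba₁ : ω ∈ inConn (↑(GM.ball z (2 * n)) : Set (Site 3)) b a₁ :=
      mem_inConn_of_mem_openConnIn hω hbQ2 (hUk b hbQ a₁ ha₁Q hb_bdry ha₁_bdry)
    -- everything inside the long box `R_{k+1}`
    set R : Set (Site 3) := {x : Site 3 | ((n : ℤ) ≤ x 0 ∧ x 0 ≤ 3 * (n : ℤ) * (k + 1 : ℕ) + 2 * n) ∧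
        (-(2 * n : ℤ) ≤ x 1 ∧ x 1 ≤ 2 * n) ∧ (-(2 * n : ℤ) ≤ x 2 ∧ x 2 ≤ 2 * n)} with hR
    have hRk : {x : Site 3 | ((n : ℤ) ≤ x 0 ∧ x 0 ≤ 3 * (n : ℤ) * k + 2 * n) ∧
        (-(2 * n : ℤ) ≤ x 1 ∧ x 1 ≤ 2 * n) ∧ (-(2 * n : ℤ) ≤ x 2 ∧ x 2 ≤ 2 * n)} ⊆ R := by
      intro x hx
      simp only [hR, Set.mem_setOf_eq] at hx ⊢
      push_cast at hx ⊢
      omega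
    have hQR : (↑(GM.ball z (2 * n)) : Set (Site 3)) ⊆ R := by
      intro x hx
      rw [Finset.mem_coe, hz, mem_ball_axis_iff] at hx
      simp only [hR, Set.mem_setOf_eq]
      push_cast at hx ⊢
      omega
    have hab' : ω ∈ inConn R a b := inConn_mono hRk a b hab
    have hba₁' : ω ∈ inConn R b a₁ := inConn_mono hQR b a₁ hba₁
    have ha₁b₁' : ω ∈ inConn R a₁ b₁ := inConn_mono (hslab_k1.trans hQR) a₁ b₁ ha₁b₁
    exact ⟨a, ha, b₁, hb₁, a₁, ha₁, inConn_inter_subset R a a₁ b₁ ⟨inConn_inter_subset R a b a₁ ⟨hab', hba₁'⟩, ha₁b₁'⟩,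
      ha₁b₁⟩

end Summit.CriticalPhenomena.PercolationContinuityZ3.Theorems.Crossing

end
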